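import Summits.CriticalPhenomena.PercolationContinuityZ3.Theorems.FK.SamePContinuationFK
import HarnessLib

/-!
# FK-continuity transplant, FO-11 (3b/4): the continuation principle over ABSTRACT finite-volume failure
# laws — the form consumed by the cell's crux C1 (`FKRobustLawful`, pinned per-direction laws)

Cell `fk-continuity` (bschramm), row FO-11 (C2); support file for the FK-continuity transplant
(`--supports stmt-CriticalPhenomena-4575`); builds on p205010 (kernel theorem, internal audit signed; external
expert review pending).  No named facts, no sorries, standard axioms.

`SamePContinuationFK.lean` proves C2 for schemes whose probe regions are disjoint from everything revealed
(`SameP.RegionLawful`, free-region laws).  Kozma–Nitzan's regions are not of that kind: the region examined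
after a history CONTAINS the revealed open cluster, and the worst-case finite-volume law PINS the revealed
pattern (cell row FO-05, `FKRobustLawful`, "Level C": per onward direction the `fkLaw` of the region with the
minimal weighting — fresh lattice edges at density `p`, revealed-open edges pinned open, everything else
deleted).  The continuation argument does not care what the finite-volume laws are; it uses three facts about
the worst-case failure NUMBERS `c(p′, h, e)`:

* (fail)      `c(p, h, e) ≤ ε` at the scheme's own density `p` — the content of C1;
* (lipschitz) `|c(p′, h, e) - c(p, h, e)| ≤ L · |p′ - p|` for `p′` in a margin interval `[δ, 1-δ] ∋ p` —
              Grimmett 2006 Thm (2.43) for the pinned laws (cell row FO-09: `FK.abs_rcMeasureW_condWeights_…`,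
              constant = number of fresh edges `/ (δ(1-δ))`);
* (dom)       for every infinite-volume random-cluster measure `P′` at `(p′, q)` of a stated class, the
              CONDITIONAL failure probability given the past is at most `c(p′, h, e)` — the domain Markov /
              comparison step (Grimmett 2006 Lemma (4.13)/(4.14)(b) with the history's pins credited; cell rows
              FO-06a/FO-10a; for pin-free regions it is `FKGibbs.le_free_mul_of_isLowerSet`, file 3).

`SameP.LawLawful S q 𝒬 c p δ L ε` packages these (with the `probes` clause and `U₀ ⊆ E_{Λ₀}`), the class of
measures being `FKGibbs d p′ q P′ ∧ 𝒬 p′ P′` for an arbitrary side predicate `𝒬` (e.g. "is the free box limit"),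
and this file proves:

* `LawLawful.condLawful` — at every `p′ ∈ [δ, 1-δ]` and every measure of the class, the scheme is conditionally
  lawful with `ε + L|p′ - p|` (file 2's `SameP.CondLawful`);
* **C2** `LawLawful.exists_lt_forall_percolates` — `ε < 2⁻³²`, `q ≥ 1`, `δ < p`, infinite macro-cluster forcing
  `0 ↔ ∞` ⇒ some `p′ < p` at which every measure of the class percolates; `LawLawful.rcCriticalProb_lt` —
  hence `p_c(q) < p` when the class is inhabited at every density (Prop. (5.11): `P′(0 ↔ ∞) ≤ θ¹`).

So the cell's C2 over C1 reduces to instantiating `fail` (C1 verbatim), `lipschitz` (FO-09) and `dom` (the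
pinned domination lemma in infinite volume) — each a statement about the C1 owner's named law.

## References

* G. Kozma, S. Nitzan, arXiv:2401.12397 (2024), §1 p. 2 (approach 1), §4 p. 25. [KozmaNitzan2024]
* G. Grimmett, *The Random-Cluster Model*, Springer 2006: Thm (2.43) p. 34; Lemma (4.13) p. 71, (4.14)(b)
  p. 72; (5.2), Prop. (5.11) p. 100. [Grimmett2006]
-/

noncomputable section

namespace Summit.CriticalPhenomena.PercolationContinuityZ3.Theorems.FK

open MeasureTheory ProbabilityTheory Literature.Probability.Percolation Literature.Probability.LatticeModels
open Literature.Probability.Percolation.ProbeHistory Literature.Probability.Percolation.HSiteScheme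
open Literature.Barriers.CriticalPhenomena
open scoped ENNReal Classical

namespace SameP

variable {d : ℕ}

/-- **Scheme lawful through abstract worst-case failure numbers** `c p′ h e` (see the module docstring):
probes made along lattice configurations; `U₀ ⊆ E_{Λ₀}`; margin `0 < δ < p ≤ 1 - δ`; (fail) `c p h e ≤ ε`;
(lipschitz) `|c p′ h e - c p h e| ≤ L|p′ - p|` on `[δ, 1-δ]`, `0 ≤ L`; (dom) under every measure `P′` with
`FKGibbs d p′ q P′ ∧ 𝒬 p′ P′`, `p′ ∈ [δ, 1-δ]`, the probe after `h` fails with conditional probability at most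
`c p′ h e` given the past.  Cell C1 (`FKRobustLawful`, Level C) supplies `fail` with `c` = the pinned
per-direction `fkLaw` failure probability (summed over onward directions).
[cite: KozmaNitzan2024, §4 p. 25 (Definition of an exploration process, (3)–(5))] -/
structure LawLawful (S : HSiteScheme (Site d)) (q : ℝ) (𝒬 : ℝ → Measure (BondConfig (Site d)) → Prop)
    (c : ℝ → ProbeHistory (Site d) → Site 2 × MDir → ℝ) (p δ L ε : ℝ) : Prop where
  /-- along the run on a lattice configuration, a probe is made whenever a candidate exists -/
  probes : ∀ ω : BondConfig (Site d), ω ⊆ (zdGraph d).edgeSet → ∀ n,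
    (S.stN n ω).choice ≠ none → S.E.next (S.E.hist n ω) ≠ none
  /-- the initial edges lie in the edge set of a finite region -/
  init : ∃ Λ₀ : Finset (Site d), (↑S.U₀ : Set (Sym2 (Site d))) ⊆ ↑(edgesIn (zdGraph d) Λ₀)
  /-- the margin: `0 < δ < p ≤ 1 - δ` -/
  pos : 0 < δ
  mem_Ioc : p ∈ Set.Ioc δ (1 - δ)
  /-- the Lipschitz constant is nonnegative -/
  nonneg : 0 ≤ L
  /-- (fail) the worst-case failure numbers at `p` are at most `ε` -/
  fail : ∀ h P e, S.E.next h = some P → (S.mst h).choice = some e → c p h e ≤ ε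
  /-- (lipschitz) the failure numbers are `L`-Lipschitz in the density on the margin interval -/
  lipschitz : ∀ h P e, S.E.next h = some P → (S.mst h).choice = some e →
    ∀ p' ∈ Set.Icc δ (1 - δ), |c p' h e - c p h e| ≤ L * |p' - p|
  /-- (dom) conditional failure bound under every measure of the class at `p′` -/
  dom : ∀ p' ∈ Set.Icc δ (1 - δ), ∀ P' : Measure (BondConfig (Site d)), FKGibbs d p' q P' → 𝒬 p' P' →
    ∀ (n : ℕ) h P e, S.E.next h = some P → (S.mst h).choice = some e →
      P'.real (S.initEvent ∩ {ω | S.E.hist n ω = h} ∩ {ω | ¬S.succ h e (P.read ω)}) ≤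
        c p' h e * P'.real (S.initEvent ∩ {ω | S.E.hist n ω = h})

namespace LawLawful

variable {S : HSiteScheme (Site d)} {q : ℝ} {𝒬 : ℝ → Measure (BondConfig (Site d)) → Prop}
  {c : ℝ → ProbeHistory (Site d) → Site 2 × MDir → ℝ} {p δ L ε : ℝ}

/-- **Conditional lawfulness at nearby densities**: at `p′ ∈ [δ, 1-δ]`, under every measure of the class, the
scheme is conditionally lawful with `ε + L|p′ - p|` ((dom), then (lipschitz) and (fail)).
[cite: Grimmett2006, Thm (2.43) and Lemma (4.13)/(4.14)(b)] -/
theorem condLawful (hR : LawLawful S q 𝒬 c p δ L ε) {p' : ℝ} (hp' : p' ∈ Set.Icc δ (1 - δ))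
    {P : Measure (BondConfig (Site d))} (hG : FKGibbs d p' q P) (hQ : 𝒬 p' P) :
    CondLawful S P (zdGraph d) (ε + L * |p' - p|) := by
  refine ⟨hR.probes, hG.ae_subset_edgeSet, fun n h Pr e hP he => ?_⟩
  have h1 := hR.dom p' hp' P hG hQ n h Pr e hP he
  have h2 : c p' h e ≤ ε + L * |p' - p| := by
    have := (abs_le.1 (hR.lipschitz h Pr e hP he p' hp')).2
    linarith [hR.fail h Pr e hP he]
  exact h1.trans (mul_le_mul_of_nonneg_right h2 measureReal_nonneg)

/-- **C2 over abstract laws: percolation under every measure of the class at some `p′ < p`.**  For a scheme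
lawful through `c` at `(p, ε)` with `ε < 2⁻³²`, `q ≥ 1`, whose infinite final macro-cluster forces `0 ↔ ∞`,
there is `p′ ∈ [δ, 1-δ]`, `p′ < p`, such that every `P′` with `FKGibbs d p′ q P′ ∧ 𝒬 p′ P′` has
`P′(0 ↔ ∞) > 0` (files 1–2: conditional Peierls driver; `FKGibbs.initEvent_pos`).
[cite: KozmaNitzan2024, §1 p. 2 (approach 1) and §4 p. 25] -/
theorem exists_lt_forall_percolates (hR : LawLawful S q 𝒬 c p δ L ε) (hε : ε < (1 / 2) ^ 32) (hq : 1 ≤ q)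
    (hperc : S.initEvent ∩ {ω | (S.occFinal ω).Infinite} ⊆
      percolatesAt (0 : Site d) ∪ {ω | ¬ω ⊆ (zdGraph d).edgeSet}) :
    ∃ p' : ℝ, p' ∈ Set.Icc δ (1 - δ) ∧ 0 < p' ∧ p' < p ∧
      ∀ P : Measure (BondConfig (Site d)), FKGibbs d p' q P → 𝒬 p' P → 0 < P.real (percolatesAt (0 : Site d)) := by
  have hδ := hR.pos
  obtain ⟨hδp, hp1⟩ := hR.mem_Ioc
  -- the step `η` and the new density `t`
  set η : ℝ := ((1 / 2 : ℝ) ^ 32 - ε) / (L + 1) with hη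
  have hL1 : 0 < L + 1 := by linarith [hR.nonneg]
  have hη0 : 0 < η := div_pos (sub_pos.2 hε) hL1
  set t : ℝ := max ((δ + p) / 2) (p - η) with ht
  have htδ : δ ≤ t := le_trans (by linarith) (le_max_left _ _)
  have htp : t < p := max_lt (by linarith) (by linarith)
  have htI : t ∈ Set.Icc δ (1 - δ) := ⟨htδ, by linarith⟩
  have ht0 : 0 < t := hδ.trans_le htδ
  have htη : |t - p| ≤ η := by
    rw [abs_sub_comm, abs_of_nonneg (by linarith)]
    linarith [le_max_right ((δ + p) / 2) (p - η)]
  refine ⟨t, htI, ht0, htp, fun P hG hQ => ?_⟩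
  haveI := hG.isProbabilityMeasure
  have hε' : ε + L * |t - p| ≤ (1 / 2) ^ 32 := by
    have h1 : L * |t - p| ≤ L * η := mul_le_mul_of_nonneg_left htη hR.nonneg
    have h2 : L * η ≤ (L + 1) * η := by nlinarith
    have hL1' : L + 1 ≠ 0 := ne_of_gt hL1
    have h3 : (L + 1) * η = (1 / 2) ^ 32 - ε := by
      rw [hη]; field_simp
    linarith
  have hL := hR.condLawful htI hG hQ
  obtain ⟨Λ₀, hU⟩ := hR.init
  have h3 := hL.measureReal_initEvent_le_three_mul_percolatesAt hε' hperc
  have hA0 := FKGibbs.initEvent_pos hU ⟨ht0, htI.2.trans (by linarith)⟩ hq hG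
  linarith

/-- **C2 over abstract laws, critical-point form: `p_c(q) < p`**, provided the class of measures is inhabited at
every density in `[0,1]` (for `𝒬` = "free box limit": cell rows FO-06a-2/FO-06b) — at the `p′ < p` of
`exists_lt_forall_percolates`, `0 < P′(0 ↔ ∞) ≤ θ¹(p′, q)` (`real_percolatesAt_le_thetaWired`) and
`p_c(q) ≤ p′` by monotonicity of `θ¹` (`rcCriticalProb_le_of_thetaWired_pos`).
[cite: KozmaNitzan2024, §1 p. 2 (approach 1)] -/
theorem rcCriticalProb_lt (hR : LawLawful S q 𝒬 c p δ L ε) (hε : ε < (1 / 2) ^ 32) (hq : 1 ≤ q)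
    (hperc : S.initEvent ∩ {ω | (S.occFinal ω).Infinite} ⊆
      percolatesAt (0 : Site d) ∪ {ω | ¬ω ⊆ (zdGraph d).edgeSet})
    (hex : ∀ p' ∈ Set.Icc (0 : ℝ) 1, ∃ P : Measure (BondConfig (Site d)), FKGibbs d p' q P ∧ 𝒬 p' P) :
    rcCriticalProb d q < p := by
  obtain ⟨p', hp'I, hp'0, hp'p, hall⟩ := hR.exists_lt_forall_percolates hε hq hperc
  have hp'01 : p' ∈ Set.Icc (0 : ℝ) 1 := ⟨hp'0.le, hp'I.2.trans (by linarith [hR.pos])⟩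
  obtain ⟨P, hG, hQ⟩ := hex p' hp'01
  have hθ : 0 < thetaWired d p' q :=
    (hall P hG hQ).trans_le (real_percolatesAt_le_thetaWired hG hp'01 (one_pos.trans_le hq))
  exact (rcCriticalProb_le_of_thetaWired_pos hq hp'01 hθ).trans_lt hp'p

end LawLawful

/-- **No law-lawful bounded scheme at `p_c(q)`** (barrier sanity, cell row FO-12, conditional form): if the class of
measures is inhabited at every density in `[0,1]`, no history-driven scheme is `LawLawful` at `p = p_c(q)` with
`ε < 2⁻³²` and an infinite macro-cluster forcing `0 ↔ ∞` — otherwise `p_c(q) < p_c(q)`.  (Consistent with the tree's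
`RandomClusterFirstOrderNarrow`: for `q > Q(d)` free regions ARE subcritical at `p_c(q)`, so no such scheme is
expected; the unconditional `¬ UFSC0 3 q p_c(q) r ε₀` is C2 ∘ C3b and waits for the cell's FT-07.)
[cite: KozmaNitzan2024, §1 p. 2 (approach 1)] -/
theorem not_lawLawful_rcCriticalProb {S : HSiteScheme (Site d)} {q : ℝ} (hq : 1 ≤ q)
    {𝒬 : ℝ → Measure (BondConfig (Site d)) → Prop}
    (hex : ∀ p' ∈ Set.Icc (0 : ℝ) 1, ∃ P : Measure (BondConfig (Site d)), FKGibbs d p' q P ∧ 𝒬 p' P)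
    {c : ℝ → ProbeHistory (Site d) → Site 2 × MDir → ℝ} {δ L ε : ℝ} (hε : ε < (1 / 2) ^ 32)
    (hperc : S.initEvent ∩ {ω | (S.occFinal ω).Infinite} ⊆
      percolatesAt (0 : Site d) ∪ {ω | ¬ω ⊆ (zdGraph d).edgeSet}) :
    ¬LawLawful S q 𝒬 c (rcCriticalProb d q) δ L ε := fun hR =>
  lt_irrefl _ (hR.rcCriticalProb_lt hε hq hperc hex)

end SameP

end Summit.CriticalPhenomena.PercolationContinuityZ3.Theorems.FK

end
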